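import Literature.ModelTheory.ExponentialFields.Wilkie1996JacobianColumns
import Literature.ModelTheory.ExponentialFields.Wilkie1996Lemma93Valuation
import HarnessLib

/-!
# Wilkie 1996, §11 / den Besten, Lemma 7.2.4 assembled: the boundedness leaf from a closure operator

Topic `Literature/ModelTheory/ExponentialFields`.  The boundedness leaf
`Wilkie1996_expPolynomialPoints_bounded` (A. J. Wilkie, J. Amer. Math. Soc. 9 (1996), §9) is
reduced in this tree to the hypothesis `hVR` of `Wilkie1996_expPolynomialPoints_bounded_of_valRank`
(`Wilkie1996Lemma93Valuation.lean`; M. den Besten, MSc thesis, Utrecht 2016, Lemmas 7.2.2–7.2.3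
and (36)): for every non-singular zero `ᾱ` of a square system from `Mˢₙ` over `k ⊆ K`, an
intermediate field containing `k`, `ᾱ_s`, `exp ᾱ_s` of valuation rank `≤ |s|` over `k`.  In the
source that field is `k* = Dcl_{k'}(ᾱ, exp ᾱ_s)`, the definable closure in the `T_e`-reduct, and
the rank bound is `valdim_{k'} k* ≤ dim_{k'} k* ≤ |s|` — the valuation inequality for the smooth
o-minimal theory `T_e` (Theorems 7.1.23, 7.2.1, resting on the First Main Theorem) together with
the **Claim** of Lemma 7.2.4 (`dim_{k'} k* ≤ |s|`), whose algebraic content is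
`RealExpModel.IsMsZero.exists_selection` (`Wilkie1996JacobianColumns.lean`).

This file **assembles Lemma 7.2.4**: it derives `hVR` — hence the leaf, Wilkie's theorem
`wilkie_isModelComplete` and `Wilkie1996_expPolynomial_transfer` — from the existence, on every
pair of models `f : k ↪ K` of `T_exp`, of an operator `cl : Set K → Subfield K` such that for
every finite tuple `a ∈ Kᵗ` the field `cl (range a)`

1. contains `f(k)`,
2. contains the `aⱼ`,
3. is closed under `x ↦ e(x) = exp((1 + x²)⁻¹)`,
4. contains the coordinates of every non-singular zero in `Kⁿ` of a square `y`-free system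
   (`RealExpModel.IsMsZero (Embedding.refl _ K) ∅ P' β`) whose coefficients lie in it, and
5. has valuation rank at most `t` over `k` (any `t + 1` nonzero elements have a nontrivial power
   product which is a valuation unit up to a factor from `k`).

For `cl A = Dcl_{k'}(A)` properties 1–3 are formal (`e` is a term of `L_e`), 4 is "finitely many
such points (Proposition 6.2.7 (iii), `RealExpModel.finite_setOf_isMsZero`), definable over the
coefficients, hence in `Dcl`" (with `RealExpModel.coeff_msD_mem` for the coefficients of the
Jacobian condition), and 5 is `valdim_{k'} Dcl_{k'}(a) ≤ dim_{k'} Dcl_{k'}(a) ≤ t`: the valuation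
inequality for `T_e`, the one remaining theorem below this leaf.

* `RealExpModel.coeff_specialise_mem_of_msSupported`, `RealExpModel.coeff_msD_mem` — coefficient
  control for the specialised system of the Claim and for its Jacobian;
* `RealExpModel.IsMsZero.exists_subfield_of_closure` — **Lemma 7.2.4 assembled**: the field
  `cl`(unselected generator values) contains `f(k)`, all `αᵢ`, the `exp αᵢ` (`i ∈ s`) (the
  selected values by 4, being the non-singular zero `RealExpModel.IsMsZero.isMsZero_specialise`
  of the specialised system), and has valuation rank `≤ |s|` by 5;
* `Wilkie1996_expPolynomialPoints_bounded_of_closure`, `wilkie_isModelComplete_of_closure`,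
  `Wilkie1996_expPolynomial_transfer_of_closure`.

Nothing here is a named fact.

## References

* M. den Besten, *Wilkie's Theorem and the Uniform Real Schanuel Conjecture*, MSc thesis, Utrecht
  (2016): Lemma 7.2.4 and its Claim, Lemma 7.2.3, (36) (pp. 94–98); Theorems 7.1.23, 7.2.1.
  [DenBesten2016]
* A. J. Wilkie, *Model completeness results for expansions of the ordered field of real numbers by
  restricted Pfaffian functions and the exponential function*, J. Amer. Math. Soc. 9 (1996),
  1051–1094: §§9–11. [WilkieJAMS1996]
-/

noncomputable section

open FirstOrder FirstOrder.Language FirstOrder.Language.Structure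
open MvPolynomial

namespace Literature.ModelTheory.ExponentialFields

namespace RealExpModel

variable {k K : Language.Theory.ModelType.{0, 0, 0} realExpTheory} {n : ℕ}

/-! ### The leaf from a closure operator (den Besten, Lemma 7.2.4 assembled)

With the Claim available in the form `RealExpModel.IsMsZero.exists_selection`, the hypothesis
`hVR` of `Wilkie1996_expPolynomialPoints_bounded_of_valRank` (`Wilkie1996Lemma93Valuation.lean`:
an intermediate field of valuation rank `≤ |s|` over `k` containing `ᾱ_s`, `exp ᾱ_s`) is produced
by any operator `cl : Set K → Subfield K` on each model `K` — in the source
`cl A = Dcl_{k'}(A)`, the definable closure over `k' = f(k)` in the `T_e`-reduct `K'` of `K` —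
such that, for a finite tuple `a`, `cl (range a)` (1) contains `f(k)` and (2) the `aⱼ`, (3) is
closed under `x ↦ e(x) = exp((1 + x²)⁻¹)` (a term of `L_e`), (4) contains the coordinates of every
non-singular zero in `Kⁿ` of a square `y`-free system over `K` with coefficients in it (such zeros
being finite in number, Proposition 6.2.7 (iii), and the zero set definable over the
coefficients in `L_e`), and (5) has valuation rank at most the length of `a` over `k` (the
valuation inequality `valdim_{k'} ≤ dim_{k'} ≤ |a|`, den Besten, Theorems 7.1.23 and 7.2.1, resting
on the First Main Theorem).  Properties (1)–(4) of `Dcl_{k'}` are formal; (5) is the one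
remaining theorem. -/

section Closure

variable {s : Finset (Fin n)} {P : Fin n → MvPolynomial (MsVar n) k} {α : Fin n → K}
variable {σ : Fin n → Fin n ⊕ Fin n} {f : k ↪[Language.orderedExpRing] K}

/-- Coefficients of an `f`-twisted substitution whose substitutes are symbols or constants from a
subring `D ∋ f(k)` lie in `D`. [folklore] -/
theorem coeff_eval₂Hom_mem {τ : Type} (D : Subring K) (hf : ∀ a : k, f a ∈ D)
    (g : τ → MvPolynomial (MsVar n) K) (hg : ∀ t, (∃ w', g t = X w') ∨ ∃ a ∈ D, g t = C a)
    (Q : MvPolynomial τ k) (m : MsVar n →₀ ℕ) :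
    coeff m (eval₂Hom (C.comp (toRingHom f)) g Q) ∈ D := by
  classical
  induction Q using MvPolynomial.induction_on generalizing m with
  | C a =>
    rw [eval₂Hom_C, RingHom.comp_apply, coe_toRingHom, coeff_C]
    split_ifs
    · exact hf a
    · exact D.zero_mem
  | add p q hp hq => rw [_root_.map_add, coeff_add]; exact D.add_mem (hp m) (hq m)
  | mul_X p w hp =>
    rw [_root_.map_mul, eval₂Hom_X']
    rcases hg w with ⟨w', hw'⟩ | ⟨a, ha, hw'⟩
    · rw [hw', coeff_mul_X']
      split_ifs
      · exact hp _
      · exact D.zero_mem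
    · rw [hw', mul_comm, coeff_C_mul]
      exact D.mul_mem ha (hp m)

/-- **The coefficients of the specialised system, for a presentation from `Mˢₙ`**: as
`RealExpModel.coeff_specialise_mem`, but the values `exp αⱼ` of unselected symbols `yⱼ` are only
needed for `j ∈ s` (the other `yⱼ` do not occur). [cite: DenBesten2016, Lemma 7.2.4, Claim] -/
theorem coeff_specialise_mem_of_msSupported (D : Subring K) (hf : ∀ a : k, f a ∈ D)
    (hx : ∀ j, (∀ j₁, σ j₁ ≠ Sum.inl j) →
      α j ∈ D ∧ (1 + α j ^ 2)⁻¹ ∈ D ∧ exp ((1 + α j ^ 2)⁻¹) ∈ D)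
    (hy : ∀ j ∈ s, (∀ j₁, σ j₁ ≠ Sum.inr j) → exp (α j) ∈ D)
    {Q : MvPolynomial (MsVar n) k} (hQ : MsSupported s Q) (m : MsVar n →₀ ℕ) :
    coeff m (specialise σ α f Q) ∈ D := by
  classical
  obtain ⟨Q₀, rfl⟩ := exists_rename_eq_of_vars_subset_range Q
    (Subtype.val : {w : MsVar n // w.1 = MsKind.y → w.2 ∈ s} → MsVar n) Subtype.val_injective
    fun w hw => ⟨⟨w, hQ w hw⟩, rfl⟩
  rw [specialise, eval₂Hom_rename]
  refine coeff_eval₂Hom_mem D hf _ (fun t => ?_) Q₀ m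
  have hgen : ∀ (c : Fin n ⊕ Fin n) (κ : Fin n → MsVar n) (a : K), ((∀ j₁, σ j₁ ≠ c) → a ∈ D) →
      (∃ w', selGen σ c κ a = X w') ∨ ∃ a' ∈ D, selGen σ c κ a = C a' := by
    intro c κ a ha
    unfold selGen
    cases hc : Function.partialInv σ c with
    | none =>
      refine Or.inr ⟨a, ha fun j₁ hj₁ => ?_, rfl⟩
      have hex : ∃ j, σ j = c := ⟨j₁, hj₁⟩
      simp [Function.partialInv, hex] at hc
    | some j₁ => exact Or.inl ⟨κ j₁, rfl⟩
  rcases t with ⟨⟨κ, j₀⟩, ht⟩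
  cases κ
  · exact hgen _ _ _ fun h => (hx j₀ h).1
  · exact hgen _ _ _ fun h => (hx j₀ h).2.1
  · exact hgen _ _ _ fun h => (hx j₀ h).2.2
  · exact hgen _ _ _ fun h => hy j₀ (ht rfl) h

/-- Wilkie's `∂/∂xⱼ` (over `K`) preserves the polynomials with coefficients in a subring `D ⊆ K`:
its directions `RealExpModel.msDir` have integer coefficients. [folklore] -/
theorem msD_map_mem_range (D : Subring K) (j : Fin n) (Q₀ : MvPolynomial (MsVar n) D) :
    msD K j (MvPolynomial.map D.subtype Q₀) ∈ (MvPolynomial.map (σ := MsVar n) D.subtype).range := by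
  induction Q₀ using MvPolynomial.induction_on with
  | C d => rw [map_C, msD_C]; exact zero_mem _
  | add p q hp hq => rw [_root_.map_add, _root_.map_add]; exact add_mem hp hq
  | mul_X p w hp =>
    rw [_root_.map_mul, map_X, Derivation.leibniz, smul_eq_mul, smul_eq_mul, msD_X]
    refine add_mem (mul_mem ⟨p, rfl⟩ ?_) (mul_mem ⟨X w, map_X _ _⟩ hp)
    have h2 : (C (-2) * X (MsKind.x, j) * X (MsKind.u, j) ^ 2 : MvPolynomial (MsVar n) K) ∈
        (MvPolynomial.map (σ := MsVar n) D.subtype).range :=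
      ⟨C (-2) * X (MsKind.x, j) * X (MsKind.u, j) ^ 2, by
        rw [_root_.map_mul, _root_.map_mul, _root_.map_pow, map_X, map_X, map_C, _root_.map_neg,
          map_ofNat]⟩
    have h3 : (C (-2) * X (MsKind.x, j) * X (MsKind.u, j) ^ 2 * X (MsKind.v, j) :
        MvPolynomial (MsVar n) K) ∈ (MvPolynomial.map (σ := MsVar n) D.subtype).range :=
      mul_mem h2 ⟨X _, map_X _ _⟩
    rcases w with ⟨κ, i⟩
    cases κ <;> by_cases hij : i = j <;>
      simp only [msDir, hij, if_true, if_false, zero_mem, one_mem, h2, h3]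
    exact ⟨X _, map_X _ _⟩

/-- **Coefficient control for the Jacobian**: if the coefficients of `Q` lie in a subring `D`,
so do those of `∂Q/∂xⱼ` — so the non-singularity condition of a `y`-free system with
coefficients in `D` is expressed by `y`-free polynomials with coefficients in `D` (for the
`L_e`-definability over `D` of its set of non-singular zeros). [folklore] -/
theorem coeff_msD_mem (D : Subring K) {Q : MvPolynomial (MsVar n) K} (hQ : ∀ m, coeff m Q ∈ D)
    (j : Fin n) (m : MsVar n →₀ ℕ) : coeff m (msD K j Q) ∈ D := by
  obtain ⟨Q₀, rfl⟩ : Q ∈ Set.range (MvPolynomial.map (σ := MsVar n) D.subtype) := by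
    refine mem_range_map_iff_coeffs_subset.2 fun c hc => ?_
    obtain ⟨m', -, rfl⟩ := mem_coeffs_iff.1 hc
    exact ⟨⟨_, hQ m'⟩, rfl⟩
  obtain ⟨R, hR⟩ := msD_map_mem_range D j Q₀
  rw [← hR, coeff_map]
  exact (coeff m R).2

/-- The `Fin n ⊕ Fin n`-valued selection underlying a selection among `x₁, …, xₙ, yᵢ (i ∈ s)` is
injective. [folklore] -/
theorem injective_sumMap_val {σ' : Fin n → Fin n ⊕ ↥s} (hσ' : Function.Injective σ') :
    Function.Injective fun j => (σ' j).map id ((↑) : ↥s → Fin n) :=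
  fun _ _ h => hσ' (Sum.map_injective.2 ⟨Function.injective_id, Subtype.val_injective⟩ h)

/-- **The valuation-rank field from a closure operator (den Besten, Lemma 7.2.4 assembled).**
Let `cl : Set K → Subfield K` satisfy (1)–(5) of the section header for the pair `f : k ↪ K`.
Then every non-singular zero `ᾱ` of a square system from `Mˢₙ` over `k` admits an intermediate
field — `cl` of the `|s|` unselected generator values — containing `f(k)`, all `αᵢ`, the
`exp αᵢ` (`i ∈ s`), and of valuation rank `≤ |s|` over `k`: the hypothesis `hVR` of
`Wilkie1996_expPolynomialPoints_bounded_of_valRank`. The selected values lie in it by (4), being a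
non-singular zero of the specialised system (`RealExpModel.IsMsZero.isMsZero_specialise`) whose
coefficients lie in it (`RealExpModel.coeff_specialise_mem_of_msSupported`, using (1)–(3)).
[cite: DenBesten2016, Lemma 7.2.4] -/
theorem IsMsZero.exists_subfield_of_closure (h : IsMsZero f s P α) (cl : Set K → Subfield K)
    (h1 : ∀ (t : ℕ) (a : Fin t → K) (b : k), f b ∈ cl (Set.range a))
    (h2 : ∀ (t : ℕ) (a : Fin t → K) (j : Fin t), a j ∈ cl (Set.range a))
    (h3 : ∀ (t : ℕ) (a : Fin t → K) (x : K), x ∈ cl (Set.range a) →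
      exp ((1 + x ^ 2)⁻¹) ∈ cl (Set.range a))
    (h4 : ∀ (t : ℕ) (a : Fin t → K) (n' : ℕ) (P' : Fin n' → MvPolynomial (MsVar n') K)
      (β : Fin n' → K), (∀ i m, coeff m (P' i) ∈ cl (Set.range a)) →
      IsMsZero (Embedding.refl Language.orderedExpRing K) ∅ P' β → ∀ j, β j ∈ cl (Set.range a))
    (h5 : ∀ (t : ℕ) (a : Fin t → K) (x : Fin (t + 1) → K), (∀ j, x j ∈ cl (Set.range a)) →
      (∀ j, x j ≠ 0) →
      ∃ e : Fin (t + 1) → ℤ, e ≠ 0 ∧ ∃ c : k, c ≠ 0 ∧ IsVUnit (f c * ∏ j, x j ^ e j)) :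
    ∃ S : Subfield K, (∀ b : k, f b ∈ S) ∧ (∀ i, α i ∈ S) ∧ (∀ i ∈ s, exp (α i) ∈ S) ∧
      ∀ x : Fin (s.card + 1) → K, (∀ j, x j ∈ S) → (∀ j, x j ≠ 0) →
        ∃ e : Fin (s.card + 1) → ℤ, e ≠ 0 ∧ ∃ c : k, c ≠ 0 ∧ IsVUnit (f c * ∏ j, x j ^ e j) := by
  classical
  obtain ⟨σ', hσ', hdet⟩ := h.exists_fullJacCol_det_ne_zero'
  set σ : Fin n → Fin n ⊕ Fin n := fun j => (σ' j).map id ((↑) : ↥s → Fin n) with hσdef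
  have hσ : Function.Injective σ := injective_sumMap_val hσ'
  -- the `|s|` unselected columns and their values
  let Uc : Finset (Fin n ⊕ ↥s) := Finset.univ \ Finset.univ.image σ'
  have hUc : Uc.card = s.card := by
    rw [Finset.card_sdiff_of_subset (Finset.subset_univ _),
      Finset.card_image_of_injective _ hσ', Finset.card_univ, Finset.card_univ,
      Fintype.card_sum, Fintype.card_fin, Fintype.card_coe]
    omega
  let cv : Fin n ⊕ ↥s → K := Sum.elim α fun i => exp (α i)
  let enum : Fin s.card ≃ ↥Uc := (Uc.equivFinOfCardEq hUc).symm
  let a : Fin s.card → K := fun t => cv (enum t)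
  let S : Subfield K := cl (Set.range a)
  have hunsel : ∀ c, (∀ j, σ' j ≠ c) → cv c ∈ S := by
    intro c hc
    have hcU : c ∈ Uc := by
      simp only [Uc, Finset.mem_sdiff, Finset.mem_univ, Finset.mem_image, true_and, not_exists]
      exact fun j => hc j
    have : a (enum.symm ⟨c, hcU⟩) = cv c := by simp [a]
    rw [← this]
    exact h2 _ a _
  -- the selected values, by (4)
  have hcoeff : ∀ i m, coeff m (specialise σ α f (P i)) ∈ S.toSubring := by
    intro i m
    refine coeff_specialise_mem_of_msSupported S.toSubring (fun b => h1 _ a b) (fun j hj => ?_)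
      (fun j hj hjsel => ?_) (h.1 i) m
    · have hαj : α j ∈ S := hunsel (Sum.inl j) fun j₁ hj₁ => hj j₁ (by simp [hσdef, hj₁])
      have hu : (1 + α j ^ 2)⁻¹ ∈ S := S.inv_mem (S.add_mem S.one_mem (S.pow_mem hαj 2))
      exact ⟨hαj, hu, h3 _ a _ hαj⟩
    · exact hunsel (Sum.inr ⟨j, hj⟩) fun j₁ hj₁ => hjsel j₁ (by simp [hσdef, hj₁])
  have hzero := h.isMsZero_specialise hσ (by simpa only [hσdef] using hdet)
  have hsel : ∀ j, selPt σ α j ∈ S := h4 _ a n _ _ hcoeff hzero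
  have hselval : ∀ j, selPt σ α j = cv (σ' j) := by
    intro j
    simp only [selPt, hσdef]
    cases σ' j <;> rfl
  have hall : ∀ c, cv c ∈ S := by
    intro c
    by_cases hc : ∃ j, σ' j = c
    · obtain ⟨j, rfl⟩ := hc
      rw [← hselval]
      exact hsel j
    · push Not at hc
      exact hunsel c hc
  refine ⟨S, fun b => h1 _ a b, fun i => hall (Sum.inl i), fun i hi => hall (Sum.inr ⟨i, hi⟩),
    h5 _ a⟩

end Closure

end RealExpModel

open RealExpModel in
/-- **The boundedness leaf from a closure operator** (den Besten, Lemma 7.2.4 and §7.2 assembled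
with the induction of §9): if on every pair of models `f : k ↪ K` of `T_exp` there is an operator
`cl : Set K → Subfield K` with (1) `f(k) ⊆ cl(range a)`, (2) `aⱼ ∈ cl(range a)`, (3) closure under
`e(x) = exp((1 + x²)⁻¹)`, (4) closure under coordinates of non-singular zeros of square `y`-free
systems over `K` with coefficients in it, and (5) valuation rank `≤ t` over `k` for `a ∈ Kᵗ` — all
satisfied by `cl A = Dcl_{k'}(A)` in the `T_e`-reduct once `T_e` is known to be model complete,
o-minimal and smooth (First Main Theorem; den Besten, Theorems 7.1.23, 7.2.1) — then
`Wilkie1996_expPolynomialPoints_bounded` holds. [cite: DenBesten2016, Lemma 7.2.4 and (36)] [cite: WilkieJAMS1996, §§9–11] -/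
theorem Wilkie1996_expPolynomialPoints_bounded_of_closure
    (hcl : ∀ (k K : Language.Theory.ModelType.{0, 0, 0} realExpTheory)
      (f : k ↪[Language.orderedExpRing] K), ∃ cl : Set K → Subfield K,
      (∀ (t : ℕ) (a : Fin t → K) (b : k), f b ∈ cl (Set.range a)) ∧
      (∀ (t : ℕ) (a : Fin t → K) (j : Fin t), a j ∈ cl (Set.range a)) ∧
      (∀ (t : ℕ) (a : Fin t → K) (x : K), x ∈ cl (Set.range a) →
        exp ((1 + x ^ 2)⁻¹) ∈ cl (Set.range a)) ∧
      (∀ (t : ℕ) (a : Fin t → K) (n' : ℕ) (P' : Fin n' → MvPolynomial (MsVar n') K)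
        (β : Fin n' → K), (∀ i m, MvPolynomial.coeff m (P' i) ∈ cl (Set.range a)) →
        IsMsZero (Embedding.refl Language.orderedExpRing K) ∅ P' β →
        ∀ j, β j ∈ cl (Set.range a)) ∧
      (∀ (t : ℕ) (a : Fin t → K) (x : Fin (t + 1) → K), (∀ j, x j ∈ cl (Set.range a)) →
        (∀ j, x j ≠ 0) →
        ∃ e : Fin (t + 1) → ℤ, e ≠ 0 ∧ ∃ c : k, c ≠ 0 ∧ IsVUnit (f c * ∏ j, x j ^ e j))) :
    Wilkie1996_expPolynomialPoints_bounded := by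
  refine Wilkie1996_expPolynomialPoints_bounded_of_valRank fun k K f n s P α h => ?_
  obtain ⟨cl, h1, h2, h3, h4, h5⟩ := hcl k K f
  obtain ⟨S, hk, hα, he, hr⟩ := h.exists_subfield_of_closure cl h1 h2 h3 h4 h5
  exact ⟨S, hk, fun i _ => hα i, he, hr⟩

open RealExpModel in
/-- **Wilkie's theorem from a closure operator**: under the hypothesis of
`Wilkie1996_expPolynomialPoints_bounded_of_closure`, `T_exp` is model complete. [cite: WilkieJAMS1996, Second Main Theorem and §§9–11] -/
theorem wilkie_isModelComplete_of_closure
    (hcl : ∀ (k K : Language.Theory.ModelType.{0, 0, 0} realExpTheory)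
      (f : k ↪[Language.orderedExpRing] K), ∃ cl : Set K → Subfield K,
      (∀ (t : ℕ) (a : Fin t → K) (b : k), f b ∈ cl (Set.range a)) ∧
      (∀ (t : ℕ) (a : Fin t → K) (j : Fin t), a j ∈ cl (Set.range a)) ∧
      (∀ (t : ℕ) (a : Fin t → K) (x : K), x ∈ cl (Set.range a) →
        exp ((1 + x ^ 2)⁻¹) ∈ cl (Set.range a)) ∧
      (∀ (t : ℕ) (a : Fin t → K) (n' : ℕ) (P' : Fin n' → MvPolynomial (MsVar n') K)
        (β : Fin n' → K), (∀ i m, MvPolynomial.coeff m (P' i) ∈ cl (Set.range a)) →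
        IsMsZero (Embedding.refl Language.orderedExpRing K) ∅ P' β →
        ∀ j, β j ∈ cl (Set.range a)) ∧
      (∀ (t : ℕ) (a : Fin t → K) (x : Fin (t + 1) → K), (∀ j, x j ∈ cl (Set.range a)) →
        (∀ j, x j ≠ 0) →
        ∃ e : Fin (t + 1) → ℤ, e ≠ 0 ∧ ∃ c : k, c ≠ 0 ∧ IsVUnit (f c * ∏ j, x j ^ e j))) :
    wilkie_isModelComplete :=
  wilkie_isModelComplete_of_expPolynomialPoints_bounded
    (Wilkie1996_expPolynomialPoints_bounded_of_closure hcl)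

open RealExpModel in
/-- **Wilkie's core transfer statement from a closure operator** (`Wilkie1996_expPolynomial_transfer`,
Wilkie 1999, p. 414). [cite: WilkieJAMS1996, Second Main Theorem and §§9–11] -/
theorem Wilkie1996_expPolynomial_transfer_of_closure
    (hcl : ∀ (k K : Language.Theory.ModelType.{0, 0, 0} realExpTheory)
      (f : k ↪[Language.orderedExpRing] K), ∃ cl : Set K → Subfield K,
      (∀ (t : ℕ) (a : Fin t → K) (b : k), f b ∈ cl (Set.range a)) ∧
      (∀ (t : ℕ) (a : Fin t → K) (j : Fin t), a j ∈ cl (Set.range a)) ∧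
      (∀ (t : ℕ) (a : Fin t → K) (x : K), x ∈ cl (Set.range a) →
        exp ((1 + x ^ 2)⁻¹) ∈ cl (Set.range a)) ∧
      (∀ (t : ℕ) (a : Fin t → K) (n' : ℕ) (P' : Fin n' → MvPolynomial (MsVar n') K)
        (β : Fin n' → K), (∀ i m, MvPolynomial.coeff m (P' i) ∈ cl (Set.range a)) →
        IsMsZero (Embedding.refl Language.orderedExpRing K) ∅ P' β →
        ∀ j, β j ∈ cl (Set.range a)) ∧
      (∀ (t : ℕ) (a : Fin t → K) (x : Fin (t + 1) → K), (∀ j, x j ∈ cl (Set.range a)) →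
        (∀ j, x j ≠ 0) →
        ∃ e : Fin (t + 1) → ℤ, e ≠ 0 ∧ ∃ c : k, c ≠ 0 ∧ IsVUnit (f c * ∏ j, x j ^ e j))) :
    Wilkie1996_expPolynomial_transfer :=
  Wilkie1996_expPolynomial_transfer_of_expPolynomialPoints_bounded
    (Wilkie1996_expPolynomialPoints_bounded_of_closure hcl)

end Literature.ModelTheory.ExponentialFields
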